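import Summits.Ventures.PercRepro.ProfilePointedCircuitClassesSixTop
import Summits.Ventures.PercRepro.ProfilePointedCircuitClassesSevenE

/-!
# PercRepro — THE PER-PAIR IN–OUT INEQUALITY AT THE BOTTOM OF NULLITY 5: THE DEPENDENT AND TWIN CASES (p5, gen 42;
`proofs/P5-GM1.md` §63)

What is a theorem about `InOutPairBottomFive` (`thru_5(S) ≤ thru_{n−6}(S)` for pairs `S` on `#E = ρ(E) + 5`,
`ρ(E) ≥ 7`): a dependent pair has `thru_5(S) = 0`; and if a point `s₁ ∈ S` has a parallel twin `f`, the
bi-independent sets through `S = {s₁, s₂}` are the members of the class of the circuit `{s₁} + f` that contain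
`s₂`, in bijection (`W ↦ W − s₁`) with the bi-independent sets of the nullity-4 minor `N ／ f ∖ s₁` through `s₂`
(`card_class_thru_eq_thruCount_contract_delete`, the reduction `gammaC_eq_thruCount_contract_delete` with an extra
set `T` carried along), so `thru_5(S) = in_4(s₂)` and `thru_{n−6}(S) = in_{n−7}(s₂) = out_5(s₂)` on the minor, and
the claim is `inOutBottomFour_holds` there.  Hence **`InOutPairBottomFive` holds as soon as it holds for independent
pairs both of whose points are twin-free** (`inOutPairBottomFive_of_twinFree`).
-/

open scoped Matroid

namespace PercRepro.Cogirth

open Finset ThmH Skew Shadow Profile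

variable {α : Type} [DecidableEq α] {N : Matroid α} [N.Finite]

section PairFive

/-- **THE REDUCTION WITH A SET CARRIED ALONG**: for a circuit `C + x`, `w ∈ C`, a set `T` avoiding `x` and `w`, and
`k ≥ 1`, the members of the class of `(x, C)` at the level `k` that contain `T` are in bijection (`W ↦ W − w`) with the
bi-independent `(k − 1)`-sets of `N ／ x ∖ w` containing `(C − w) ∪ T`. -/
theorem card_class_thru_eq_thruCount_contract_delete {x : α} {C : Finset α} (hC : C ⊆ gr N) (hx : x ∈ gr N)
    (hxC : x ∉ C) (hrk : rk N C = C.card) (hxcl : x ∈ clF N C) (hfund : ∀ c ∈ C, x ∉ clF N (C.erase c))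
    {w : α} (hw : w ∈ C) {T : Finset α} (hxT : x ∉ T) (hwT : w ∉ T) {k : ℕ} (hk : 1 ≤ k) :
    ((biIndepSets N k).filter (fun W => C ⊆ W ∧ x ∉ W ∧ T ⊆ W)).card =
      thruCount ((N ／ ({x} : Set α)) ＼ ({w} : Set α)) (k - 1) (C.erase w ∪ T) := by
  have hwg : w ∈ gr N := hC hw
  have hxw : x ≠ w := fun h => hxC (h ▸ hw)
  have hwcl : w ∈ clF N (insert x (C.erase w)) :=
    mem_clF_insert_erase_of_circuit hC hx hrk hxcl hw (hfund w hw)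
  have hx1 : rk N {x} = 1 := by
    have h := rk_insert_eq hx (empty_subset (gr N)) (M := N)
    rw [insert_empty] at h
    have hxe : x ∉ clF N ∅ := by
      intro h0
      exact hfund w hw (mem_clF_of_subset (empty_subset _) h0)
    rw [if_neg hxe] at h
    have h0 : rk N ∅ = 0 := Nat.le_zero.1 ((rk_le_card (M := N) ∅).trans (by rw [card_empty]))
    omega
  have hxind : N.Indep ({x} : Set α) := by
    have := indep_of_rk_eq_card' (M := N) (X := {x}) (by rw [hx1, card_singleton])
    simpa using this
  have hgr₀ : gr ((N ／ ({x} : Set α)) ＼ ({w} : Set α)) = ((gr N).erase x).erase w := by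
    rw [gr_delete', gr_contract']
  have hrk₀ : ∀ X : Finset α, X ⊆ ((gr N).erase x).erase w →
      rk ((N ／ ({x} : Set α)) ＼ ({w} : Set α)) X + 1 = rk N (insert x X) := by
    intro X hX
    have hX' : X ⊆ (gr (N ／ ({x} : Set α))).erase w := by rw [gr_contract']; exact hX
    have hX'' : X ⊆ (gr N).erase x := hX.trans (erase_subset _ _)
    rw [rk_delete hX', rk_contract_add_one hxind hX'']
  unfold thruCount
  apply card_nbij' (fun W => W.erase w) (fun X => insert w X)
  · intro W hW
    rw [mem_coe, mem_filter, mem_biIndepSets] at hW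
    obtain ⟨⟨hWg, hWcard, hWrk, hWcompl⟩, hCW, hxW, hTW⟩ := hW
    have hwW : w ∈ W := hCW hw
    rw [mem_coe, mem_filter, mem_biIndepSets, hgr₀]
    simp only
    have hWeg : W.erase w ⊆ ((gr N).erase x).erase w := by
      intro a ha
      rw [mem_erase] at ha
      exact mem_erase.2 ⟨ha.1, mem_erase.2 ⟨fun h => hxW (h ▸ ha.2), hWg ha.2⟩⟩
    have hSW : C.erase w ⊆ W.erase w := by
      intro a ha
      rw [mem_erase] at ha ⊢
      exact ⟨ha.1, hCW ha.2⟩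
    have hTW' : T ⊆ W.erase w := by
      intro a ha
      rw [mem_erase]
      exact ⟨fun h => hwT (h ▸ ha), hTW ha⟩
    refine ⟨⟨hWeg, ?_, ?_, ?_⟩, union_subset hSW hTW'⟩
    · rw [card_erase_of_mem hwW, hWcard]
    · have h := hrk₀ (W.erase w) hWeg
      have hwcl' : w ∈ clF N (insert x (W.erase w)) :=
        mem_clF_of_subset (insert_subset_insert x hSW) hwcl
      have r1 : rk N (insert w (insert x (W.erase w))) = rk N (insert x (W.erase w)) := by
        rw [rk_insert_eq hwg (insert_subset hx ((erase_subset _ _).trans hWg)), if_pos hwcl']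
      have e : insert w (insert x (W.erase w)) = insert x W := by
        ext a
        simp only [mem_insert, mem_erase]
        constructor
        · rintro (rfl | rfl | ⟨_, h⟩)
          · exact Or.inr hwW
          · exact Or.inl rfl
          · exact Or.inr h
        · rintro (rfl | h)
          · exact Or.inr (Or.inl rfl)
          · by_cases haw : a = w
            · exact Or.inl haw
            · exact Or.inr (Or.inr ⟨haw, h⟩)
      have r3 : rk N (insert x W) = rk N W := by
        rw [rk_insert_eq hx hWg, if_pos (mem_clF_of_subset hCW hxcl)]
      rw [e, r3, hWrk] at r1
      rw [card_erase_of_mem hwW]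
      omega
    · have e : ((gr N).erase x).erase w \ W.erase w = (gr N \ W).erase x := by
        ext a
        simp only [mem_sdiff, mem_erase]
        constructor
        · rintro ⟨⟨haw, hax, hag⟩, h⟩
          exact ⟨hax, hag, fun haW => h ⟨haw, haW⟩⟩
        · rintro ⟨hax, hag, haW⟩
          exact ⟨⟨fun h => haW (h ▸ hwW), hax, hag⟩, fun h => haW h.2⟩
      rw [e]
      have hYg : (gr N \ W).erase x ⊆ ((gr N).erase x).erase w := by rw [← e]; exact sdiff_subset
      have h := hrk₀ _ hYg
      have eY : insert x ((gr N \ W).erase x) = gr N \ W := insert_erase (mem_sdiff.2 ⟨hx, hxW⟩)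
      rw [eY, hWcompl] at h
      have : 0 < (gr N \ W).card := card_pos.2 ⟨x, mem_sdiff.2 ⟨hx, hxW⟩⟩
      rw [card_erase_of_mem (mem_sdiff.2 ⟨hx, hxW⟩)]
      omega
  · intro X hX
    rw [mem_coe, mem_filter, mem_biIndepSets, hgr₀] at hX
    obtain ⟨⟨hXg, hXcard, hXrk, hXcompl⟩, hSTX⟩ := hX
    have hSX : C.erase w ⊆ X := subset_union_left.trans hSTX
    have hTX : T ⊆ X := subset_union_right.trans hSTX
    have hwX : w ∉ X := fun h => (mem_erase.1 (hXg h)).1 rfl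
    have hxX : x ∉ X := fun h => (mem_erase.1 (mem_erase.1 (hXg h)).2).1 rfl
    have hXg' : X ⊆ gr N := hXg.trans ((erase_subset _ _).trans (erase_subset _ _))
    have hCX : C ⊆ insert w X := by
      intro a ha
      rw [mem_insert]
      by_cases haw : a = w
      · exact Or.inl haw
      · exact Or.inr (hSX (mem_erase.2 ⟨haw, ha⟩))
    rw [mem_coe, mem_filter, mem_biIndepSets]
    simp only
    refine ⟨⟨insert_subset hwg hXg', ?_, ?_, ?_⟩, hCX, ?_, hTX.trans (subset_insert w X)⟩
    · rw [card_insert_of_notMem hwX, hXcard]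
      omega
    · have h := hrk₀ X hXg
      rw [hXrk, hXcard] at h
      have hxcl' : x ∈ clF N (insert w X) := mem_clF_of_subset hCX hxcl
      have hwcl' : w ∈ clF N (insert x X) := mem_clF_of_subset (insert_subset_insert x hSX) hwcl
      have r1 : rk N (insert x (insert w X)) = rk N (insert w X) := by
        rw [rk_insert_eq hx (insert_subset hwg hXg'), if_pos hxcl']
      have r2 : rk N (insert w (insert x X)) = rk N (insert x X) := by
        rw [rk_insert_eq hwg (insert_subset hx hXg'), if_pos hwcl']
      have e : insert x (insert w X) = insert w (insert x X) := by
        ext a; simp only [mem_insert]; tauto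
      rw [e, r2] at r1
      rw [card_insert_of_notMem hwX, ← r1]
      omega
    · have e : gr N \ insert w X = insert x (((gr N).erase x).erase w \ X) := by
        ext a
        simp only [mem_sdiff, mem_insert, mem_erase, not_or]
        constructor
        · rintro ⟨hag, haw, haX⟩
          by_cases hax : a = x
          · exact Or.inl hax
          · exact Or.inr ⟨⟨haw, hax, hag⟩, haX⟩
        · rintro (rfl | ⟨⟨haw, hax, hag⟩, haX⟩)
          · exact ⟨hx, hxw, hxX⟩
          · exact ⟨hag, haw, haX⟩
      rw [e]
      have hYg : ((gr N).erase x).erase w \ X ⊆ ((gr N).erase x).erase w := sdiff_subset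
      have h := hrk₀ _ hYg
      have hxY : x ∉ ((gr N).erase x).erase w \ X :=
        fun h => (mem_erase.1 (mem_erase.1 (mem_sdiff.1 h).1).2).1 rfl
      rw [hXcompl] at h
      rw [card_insert_of_notMem hxY]
      omega
    · exact fun h => hxX ((mem_insert.1 h).resolve_left hxw)
  · intro W hW
    rw [mem_coe, mem_filter] at hW
    exact insert_erase (hW.2.1 hw)
  · intro X hX
    rw [mem_coe, mem_filter, mem_biIndepSets, hgr₀] at hX
    have hwX : w ∉ X := fun h => (mem_erase.1 (hX.1.1 h)).1 rfl
    exact erase_insert hwX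

/-- A dependent set lies in no bi-independent set: `thru_k(S) = 0` when `ρ(S) < #S`. -/
theorem thruCount_eq_zero_of_rk_lt {S : Finset α} (hS : rk N S < S.card) (k : ℕ) : thruCount N k S = 0 := by
  unfold thruCount
  rw [card_eq_zero, filter_eq_empty_iff]
  intro W hW hSW
  rw [mem_biIndepSets] at hW
  have := rk_eq_card_of_subset_of_rk_eq_card hSW hW.2.2.1
  omega

/-- **THE BI-INDEPENDENT SETS THROUGH A PAIR WITH A TWIN**: for `s₁ ∥ f` and `s₂ ∉ {s₁, f}`, the bi-independent `k`-sets
containing `{s₁, s₂}` are in bijection with the bi-independent `(k − 1)`-sets of `N ／ f ∖ s₁` containing `s₂`: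
`thru_k({s₁, s₂}) = in_{k−1}(s₂)` on the minor. -/
theorem thruCount_pair_eq_inCount_of_parallel {s₁ s₂ f : α} (hs12 : s₁ ≠ s₂) (hs1f : s₁ ≠ f) (hs2f : s₂ ≠ f)
    (hs₁ : s₁ ∈ gr N) (hf : f ∈ gr N) (hr1 : rk N {s₁} = 1) (hrf : rk N {f} = 1) (hfcl : f ∈ clF N {s₁})
    {k : ℕ} (hk : 1 ≤ k) :
    thruCount N k {s₁, s₂} = inCount ((N ／ ({f} : Set α)) ＼ ({s₁} : Set α)) (k - 1) s₂ := by
  have hC : ({s₁} : Finset α) ⊆ gr N := singleton_subset_iff.2 hs₁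
  have hxC : f ∉ ({s₁} : Finset α) := by rw [mem_singleton]; exact fun h => hs1f h.symm
  have hrk : rk N {s₁} = ({s₁} : Finset α).card := by rw [hr1, card_singleton]
  have hfund : ∀ c ∈ ({s₁} : Finset α), f ∉ clF N (({s₁} : Finset α).erase c) := by
    intro c hc
    rw [mem_singleton] at hc
    rw [hc, erase_singleton]
    intro h0
    have h := rk_insert_eq hf (empty_subset (gr N)) (M := N)
    rw [insert_empty, if_pos h0] at h
    have h1 : rk N ∅ = 0 := Nat.le_zero.1 ((rk_le_card (M := N) ∅).trans (by rw [card_empty]))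
    omega
  have hxT : f ∉ ({s₂} : Finset α) := by rw [mem_singleton]; exact fun h => hs2f h.symm
  have hwT : s₁ ∉ ({s₂} : Finset α) := by rw [mem_singleton]; exact hs12
  have h := card_class_thru_eq_thruCount_contract_delete hC hf hxC hrk hfcl hfund (mem_singleton_self s₁)
    hxT hwT hk
  rw [erase_singleton, empty_union, thruCount_singleton] at h
  rw [← h]
  unfold thruCount
  congr 1
  apply filter_congr
  intro W hW
  have hW' := hW
  rw [mem_biIndepSets] at hW'
  obtain ⟨hWg, _, hWrk, _⟩ := hW'
  constructor
  · intro hSW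
    have hs₁W : s₁ ∈ W := hSW (mem_insert_self _ _)
    have hs₂W : s₂ ∈ W := hSW (mem_insert_of_mem (mem_singleton_self _))
    refine ⟨singleton_subset_iff.2 hs₁W, ?_, singleton_subset_iff.2 hs₂W⟩
    intro hfW
    -- `{s₁, f} ⊆ W` has rank `1 < 2`
    have hsub : ({s₁, f} : Finset α) ⊆ W := insert_subset hs₁W (singleton_subset_iff.2 hfW)
    have h1 := rk_eq_card_of_subset_of_rk_eq_card hsub hWrk
    rw [card_pair hs1f] at h1
    have h2 : rk N (insert f {s₁}) = rk N {s₁} := by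
      rw [rk_insert_eq hf (singleton_subset_iff.2 hs₁), if_pos hfcl]
    have e1 : ({s₁, f} : Finset α) = insert f {s₁} := pair_comm s₁ f
    rw [e1, h2, hr1] at h1
    omega
  · rintro ⟨h1, _, h2⟩
    exact insert_subset (h1 (mem_singleton_self _)) h2

/-- **THE TWIN CASE OF `InOutPairBottomFive`**: on `#E = ρ(E) + 5`, `ρ(E) ≥ 7`, an independent pair `{s₁, s₂}` whose
point `s₁` has a parallel twin `f` satisfies `thru_5({s₁, s₂}) ≤ thru_{n−6}({s₁, s₂})`: both sides are pointed counts
of the nullity-4 minor `N ／ f ∖ s₁` (`in_4(s₂)` and `in_{n−7}(s₂) = out_5(s₂)`), and `in_4 ≤ out_5` there is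
`inOutBottomFour_holds`. -/
theorem thruCount_five_le_of_parallel (hn : (gr N).card = rk N (gr N) + 5) (hR : 7 ≤ rk N (gr N))
    {s₁ s₂ f : α} (hs12 : s₁ ≠ s₂) (hs1f : s₁ ≠ f) (hs2f : s₂ ≠ f) (hs₁ : s₁ ∈ gr N) (hs₂ : s₂ ∈ gr N)
    (hf : f ∈ gr N) (hr1 : rk N {s₁} = 1) (hrf : rk N {f} = 1) (hfcl : f ∈ clF N {s₁}) :
    thruCount N 5 {s₁, s₂} ≤ thruCount N ((gr N).card - 6) {s₁, s₂} := by
  rw [thruCount_pair_eq_inCount_of_parallel hs12 hs1f hs2f hs₁ hf hr1 hrf hfcl (by norm_num),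
    thruCount_pair_eq_inCount_of_parallel hs12 hs1f hs2f hs₁ hf hr1 hrf hfcl (by omega)]
  -- the minor `N₄ := N ／ f ∖ s₁`: `n − 2` points, rank `ρ − 1`, nullity `4`
  have hC : ({s₁} : Finset α) ⊆ gr N := singleton_subset_iff.2 hs₁
  have hxC : f ∉ ({s₁} : Finset α) := by rw [mem_singleton]; exact fun h => hs1f h.symm
  have hrk : rk N {s₁} = ({s₁} : Finset α).card := by rw [hr1, card_singleton]
  have hfund : ∀ c ∈ ({s₁} : Finset α), f ∉ clF N (({s₁} : Finset α).erase c) := by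
    intro c hc
    rw [mem_singleton] at hc
    rw [hc, erase_singleton]
    intro h0
    have h := rk_insert_eq hf (empty_subset (gr N)) (M := N)
    rw [insert_empty, if_pos h0] at h
    have h1 : rk N ∅ = 0 := Nat.le_zero.1 ((rk_le_card (M := N) ∅).trans (by rw [card_empty]))
    omega
  obtain ⟨hgr₀, hcard₀, hrkg₀⟩ :=
    minor_facts_of_circuit hC hf hxC hrk hfcl hfund hrf (mem_singleton_self s₁)
  have hs₂g₀ : s₂ ∈ gr ((N ／ ({f} : Set α)) ＼ ({s₁} : Set α)) := by
    rw [hgr₀]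
    exact mem_erase.2 ⟨hs12.symm, mem_erase.2 ⟨hs2f, hs₂⟩⟩
  have hn₀ : (gr ((N ／ ({f} : Set α)) ＼ ({s₁} : Set α))).card =
      rk ((N ／ ({f} : Set α)) ＼ ({s₁} : Set α)) (gr ((N ／ ({f} : Set α)) ＼ ({s₁} : Set α))) + 4 := by
    rw [hcard₀, hrkg₀]
    omega
  have hR₀ : 6 ≤ rk ((N ／ ({f} : Set α)) ＼ ({s₁} : Set α)) (gr ((N ／ ({f} : Set α)) ＼ ({s₁} : Set α))) := by
    rw [hrkg₀]
    omega
  have hio := inOutBottomFour_holds ((N ／ ({f} : Set α)) ＼ ({s₁} : Set α)) s₂ hs₂g₀ hn₀ hR₀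
  have hsym := inCount_sub_eq_outCount (M := (N ／ ({f} : Set α)) ＼ ({s₁} : Set α)) (k := 5) hs₂g₀
    (by rw [hcard₀]; omega)
  rw [hcard₀] at hsym
  have e1 : (5 : ℕ) - 1 = 4 := by norm_num
  have e2 : (gr N).card - 6 - 1 = (gr N).card - 2 - 5 := by omega
  rw [e1, e2, hsym]
  exact hio

/-- **`InOutPairBottomFive` HOLDS AS SOON AS IT HOLDS FOR INDEPENDENT PAIRS BOTH OF WHOSE POINTS ARE TWIN-FREE**: a
dependent pair has `thru_5 = 0`, and a pair with a twin reduces to `inOutBottomFour_holds` on the minor. -/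
theorem inOutPairBottomFive_of_twinFree
    (h : ∀ (N : Matroid α) [N.Finite] (S : Finset α), S ⊆ gr N → S.card = 2 → rk N S = 2 →
      (gr N).card = rk N (gr N) + 5 → 7 ≤ rk N (gr N) →
      (∀ s ∈ S, ∀ f ∈ gr N, f ≠ s → rk N {f} = 1 → f ∉ clF N {s}) →
      thruCount N 5 S ≤ thruCount N ((gr N).card - 6) S) :
    InOutPairBottomFive α := by
  intro N _ S hSg hS2 hn hR
  -- dependent pair?
  by_cases hdep : rk N S < S.card
  · rw [thruCount_eq_zero_of_rk_lt hdep]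
    exact Nat.zero_le _
  have hrkS : rk N S = 2 := by
    have := rk_le_card (M := N) S
    omega
  -- a twin of a point of `S`?
  by_cases htw : ∃ s ∈ S, ∃ f ∈ gr N, f ≠ s ∧ rk N {f} = 1 ∧ f ∈ clF N {s}
  · obtain ⟨s, hs, f, hf, hfs, hrf, hfcl⟩ := htw
    obtain ⟨s₁, s₂, hs12, rfl⟩ := card_eq_two.1 hS2
    have hs₁g : s₁ ∈ gr N := hSg (mem_insert_self _ _)
    have hs₂g : s₂ ∈ gr N := hSg (mem_insert_of_mem (mem_singleton_self _))
    have hr1 : rk N {s₁} = 1 := by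
      have h1 := rk_eq_card_of_subset_of_rk_eq_card (singleton_subset_iff.2 (mem_insert_self s₁ {s₂}))
        (by rw [hrkS, card_pair hs12])
      rwa [card_singleton] at h1
    have hr2 : rk N {s₂} = 1 := by
      have h1 := rk_eq_card_of_subset_of_rk_eq_card
        (singleton_subset_iff.2 (mem_insert_of_mem (mem_singleton_self s₂) : s₂ ∈ ({s₁, s₂} : Finset α)))
        (by rw [hrkS, card_pair hs12])
      rwa [card_singleton] at h1
    -- the twin is outside the pair (else the pair would have rank `1`)
    have hfS : f ∉ ({s₁, s₂} : Finset α) := by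
      intro hfS
      have hsub : ({s, f} : Finset α) ⊆ {s₁, s₂} := insert_subset hs (singleton_subset_iff.2 hfS)
      have h1 : rk N {s, f} ≤ rk N {s} := by
        have e1 : ({s, f} : Finset α) = insert f {s} := pair_comm s f
        rw [e1, rk_insert_eq hf (singleton_subset_iff.2 (hSg hs)), if_pos hfcl]
      have h2 : rk N {s, f} = 2 := by
        have := rk_eq_card_of_subset_of_rk_eq_card hsub (by rw [hrkS, card_pair hs12])
        rwa [card_pair (fun h' => hfs h'.symm)] at this
      have h3 : rk N {s} ≤ 1 := by
        have := rk_le_card (M := N) {s}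
        rwa [card_singleton] at this
      omega
    have hfs₁ : s₁ ≠ f := fun h' => hfS (h' ▸ mem_insert_self _ _)
    have hfs₂ : s₂ ≠ f := fun h' => hfS (h' ▸ mem_insert_of_mem (mem_singleton_self _))
    rw [mem_insert, mem_singleton] at hs
    rcases hs with rfl | rfl
    · exact thruCount_five_le_of_parallel hn hR hs12 hfs₁ hfs₂ hs₁g hs₂g hf hr1 hrf hfcl
    · have e : ({s₁, s} : Finset α) = {s, s₁} := pair_comm s₁ s
      rw [e]
      exact thruCount_five_le_of_parallel hn hR hs12.symm hfs₂ hfs₁ hs₂g hs₁g hf hr2 hrf hfcl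
  · exact h N S hSg hS2 hrkS hn hR (fun s hs f hf hfs hrf hfcl => htw ⟨s, hs, f, hf, hfs, hrf, hfcl⟩)

end PairFive

end PercRepro.Cogirth
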